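import Literature.Analysis.Complex.LogDerivZeros
import Literature.Analysis.Complex.HarnackHalfPlane
import Mathlib.Analysis.Complex.AbsMax
import Mathlib.Analysis.SpecialFunctions.Log.Basic
import Mathlib.Analysis.Complex.ExponentialBounds
import HarnessLib

/-!
# A local minimum-modulus bound on a real segment

Topic `Literature/Analysis/Complex`. Everything in this file is PROVED (no named facts). It is the
local function-theoretic lemma used (in place of V. Bernstein's theorem on the growth of entire
functions along sequences, Steuding Thm. 5.9 / Boas Ch. 10) in the tree's proof of the denseness
lemma of Voronin's universality theorem
(`Literature.NumberTheory.LFunctions.Steuding2007_thm5_10_zeta_disc`):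

* `exists_Icc_norm_ge_of_norm_le` — **local minimum modulus on a real segment.** If `f` is entire,
  `c` is real, `f(c) ≠ 0` and `‖f(z)‖ ≤ e^U ‖f(c)‖` on the disc `|z - c| ≤ 15` (`U ≥ 0`), then some
  sub-interval of `[c - 1/2, c + 1/2]` of length `1/(12(U+1))` carries the lower bound
  `‖f(t)‖ ≥ e^{-(7U+1)} ‖f(c)‖`.

This is a Cartan-type estimate (cf. the Boutroux–Cartan lemma and the minimum modulus theorems
of Boas, *Entire Functions*, §3.7, and the lemma of Titchmarsh §3.9), proved here from the tree's
zero extraction (`Literature.Analysis.Complex.exists_finset_zeros_eq_prod_mul`) and Harnack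
inequality (`Complex.im_apply_le_harnack`, applied to a holomorphic logarithm,
`Literature.Analysis.Complex.exists_log_on_ball`) together with Mathlib's maximum modulus
principle:
write `f = B · h` on `|z - c| ≤ 15` with `B` the Blaschke product (radius `15`) of the zeros in
`|z - c| < 5`; then `‖h‖ ≤ e^U ‖f(c)‖` on the disc and `log ‖h(c)‖ - log ‖f(c)‖ = Σ m_a log(15/|a-c|)`
(whence the zero count `N(5) ≤ U/log 3`), Harnack gives `‖h(w)‖ ≥ e^{-(U+1)/2} ‖f(c)‖` for
`|w - c| ≤ 1`, each Blaschke factor is `≥ 15|w-a|/230`, and the product over the zeros near the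
segment is controlled by the elementary **grid lemma** `exists_cell_prod_norm_sub_ge`: for `n`
points (with multiplicity) and `M = 12(n+1)` cells of `[c - 1/2, c + 1/2]`, some cell free of
points and their neighbours satisfies `∏ |t - a|^{m_a} ≥ e^{-3n}` on it (an averaging argument over
the free cells using `M! ≥ (M/e)^M`).

## References

* [Boas1954] R. P. Boas, *Entire Functions*, Academic Press 1954, §3.7 (minimum modulus), Ch. 10.
* [Titchmarsh1986] E. C. Titchmarsh, *The Theory of the Riemann Zeta-Function*, 2nd ed., §3.9
  (Lemma: dividing out the zeros, Borel–Carathéodory).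
* [Steuding2007] J. Steuding, *Value-Distribution of L-Functions*, LNM 1877, §5.3–5.4.
-/

noncomputable section

open Complex Filter Topology Set Metric Real Finset

namespace Literature.Analysis.Complex

/-! ### The grid lemma -/

/-- `∑_{k<M} log((k+1)/M) = log(M!/M^M) ≥ -M`. [folklore] -/
theorem neg_le_sum_range_log_succ_div {M : ℕ} (hM : 0 < M) :
    -(M : ℝ) ≤ ∑ k ∈ range M, Real.log (((k : ℝ) + 1) / M) := by
  have hM' : (0 : ℝ) < M := by exact_mod_cast hM
  have hpos : ∀ k ∈ range M, (0 : ℝ) < ((k : ℝ) + 1) / M := fun k _ ↦ by positivity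
  rw [← Real.log_prod (s := range M) (f := fun k => ((k : ℝ) + 1) / (M : ℝ)) (fun k hk ↦ (hpos k hk).ne'),
    Finset.prod_div_distrib,
    Finset.prod_const, Finset.card_range]
  have hfact : ∏ k ∈ range M, ((k : ℝ) + 1) = (M.factorial : ℝ) := by
    rw [← Finset.prod_range_add_one_eq_factorial]; push_cast; rfl
  rw [hfact, Real.le_log_iff_exp_le (by positivity)]
  have h := Real.pow_div_factorial_le_exp (M : ℝ) hM'.le M
  rw [div_le_iff₀ (by positivity)] at h
  rw [Real.exp_neg, inv_le_comm₀ (Real.exp_pos _) (by positivity), inv_div,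
    div_le_iff₀ (by positivity)]
  linarith

/-- Rearrangement: for a finite set `F` of integers `≥ b` and `g` nondecreasing on `[b, ∞)`,
`∑_{k < |F|} g(b+k) ≤ ∑_{i ∈ F} g(i)` (the `k`-th smallest element of `F` is `≥ b + k`).
[folklore] -/
theorem sum_range_card_le_sum {F : Finset ℤ} {b : ℤ} (hb : ∀ i ∈ F, b ≤ i) {g : ℤ → ℝ}
    (hg : ∀ x y, b ≤ x → x ≤ y → g x ≤ g y) :
    ∑ k ∈ range F.card, g (b + k) ≤ ∑ i ∈ F, g i := by
  induction F using Finset.induction_on_max with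
  | empty => simp
  | insert a s ha ih =>
    have hb' : ∀ i ∈ s, b ≤ i := fun i hi ↦ hb i (mem_insert_of_mem hi)
    have has : a ∉ s := fun h ↦ lt_irrefl a (ha a h)
    have hba : b ≤ a := hb a (mem_insert_self a s)
    have hcard : (s.card : ℤ) + b ≤ a := by
      have hsub : s ⊆ Finset.Ico b a := fun x hx ↦ Finset.mem_Ico.2 ⟨hb' x hx, ha x hx⟩
      have h1 := Finset.card_le_card hsub
      rw [Int.card_Ico] at h1
      have h2 : ((a - b).toNat : ℤ) = a - b := Int.toNat_of_nonneg (by omega)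
      omega
    rw [sum_insert has, card_insert_of_notMem has, sum_range_succ]
    have h1 := ih hb'
    have h2 : g (b + (s.card : ℕ)) ≤ g a := hg _ _ (by omega) (by omega)
    linarith

/-- One point, one side: if all `i ∈ F` satisfy `i ≥ i₀ + 2` and `|F| ≤ M`, then
`∑_{i∈F} log((i - i₀ - 1)/M) ≥ -M`. [folklore] -/
theorem neg_le_sum_log_right {M : ℕ} (hM : 0 < M) (i₀ : ℤ) {F : Finset ℤ} (hcard : F.card ≤ M)
    (hF : ∀ i ∈ F, i₀ + 2 ≤ i) :
    -(M : ℝ) ≤ ∑ i ∈ F, Real.log (((i : ℝ) - i₀ - 1) / M) := by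
  have hM' : (0 : ℝ) < M := by exact_mod_cast hM
  set g : ℤ → ℝ := fun x ↦ min 0 (Real.log (((x : ℝ) - i₀ - 1) / M)) with hg
  have hgmono : ∀ x y, i₀ + 2 ≤ x → x ≤ y → g x ≤ g y := by
    intro x y hx hxy
    simp only [hg]
    refine min_le_min le_rfl (Real.log_le_log ?_ ?_)
    · have : (1 : ℝ) ≤ (x : ℝ) - i₀ - 1 := by
        have : ((i₀ + 2 : ℤ) : ℝ) ≤ x := by exact_mod_cast hx
        push_cast at this; linarith
      positivity
    · have : (x : ℝ) ≤ y := by exact_mod_cast hxy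
      gcongr
  calc -(M : ℝ) ≤ ∑ k ∈ range M, Real.log (((k : ℝ) + 1) / M) := neg_le_sum_range_log_succ_div hM
    _ = ∑ k ∈ range M, g (i₀ + 2 + k) := by
        refine sum_congr rfl fun k hk ↦ ?_
        simp only [hg]
        push_cast
        rw [show (i₀ : ℝ) + 2 + k - i₀ - 1 = k + 1 by ring, min_eq_right]
        apply Real.log_nonpos (by positivity)
        rw [div_le_one hM']
        have := mem_range.1 hk
        exact_mod_cast this
    _ ≤ ∑ k ∈ range F.card, g (i₀ + 2 + k) := by
        exact sum_le_sum_of_subset_of_nonpos' (range_subset_range.2 hcard) fun k _ _ ↦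
          min_le_left _ _
    _ ≤ ∑ i ∈ F, g i := sum_range_card_le_sum hF hgmono
    _ ≤ ∑ i ∈ F, Real.log (((i : ℝ) - i₀ - 1) / M) := sum_le_sum fun i _ ↦ min_le_right _ _

/-- One point, both sides: if all `i ∈ F` satisfy `|i - i₀| ≥ 2` and `|F| ≤ M`, then
`∑_{i∈F} log((|i - i₀| - 1)/M) ≥ -2M`. [folklore] -/
theorem neg_le_sum_log_abs {M : ℕ} (hM : 0 < M) (i₀ : ℤ) {F : Finset ℤ} (hcard : F.card ≤ M)
    (hF : ∀ i ∈ F, 2 ≤ |i - i₀|) :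
    -(2 * M : ℝ) ≤ ∑ i ∈ F, Real.log ((|(i : ℝ) - i₀| - 1) / M) := by
  rw [← sum_filter_add_sum_filter_not F (fun i ↦ i₀ < i)]
  -- right part
  have hR : -(M : ℝ) ≤ ∑ i ∈ F.filter (fun i ↦ i₀ < i), Real.log ((|(i : ℝ) - i₀| - 1) / M) := by
    have h1 : ∀ i ∈ F.filter (fun i ↦ i₀ < i), i₀ + 2 ≤ i := by
      intro i hi
      rw [mem_filter] at hi
      have := hF i hi.1
      rw [abs_of_pos (by omega)] at this
      omega
    calc -(M : ℝ) ≤ ∑ i ∈ F.filter (fun i ↦ i₀ < i), Real.log (((i : ℝ) - i₀ - 1) / M) :=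
          neg_le_sum_log_right hM i₀ ((card_filter_le _ _).trans hcard) h1
      _ = _ := by
          refine sum_congr rfl fun i hi ↦ ?_
          have h2 : (i₀ : ℝ) < i := by exact_mod_cast (mem_filter.1 hi).2
          rw [abs_of_pos (by linarith)]
  -- left part, by reflection `i ↦ -i`
  have hL : -(M : ℝ) ≤ ∑ i ∈ F.filter (fun i ↦ ¬ i₀ < i), Real.log ((|(i : ℝ) - i₀| - 1) / M) := by
    set FL := F.filter (fun i ↦ ¬ i₀ < i) with hFL
    have h1 : ∀ i ∈ FL, i ≤ i₀ - 2 := by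
      intro i hi
      rw [hFL, mem_filter] at hi
      have := hF i hi.1
      rw [abs_of_nonpos (by omega)] at this
      omega
    set FL' : Finset ℤ := FL.map (Equiv.neg ℤ).toEmbedding with hFL'
    have h2 : ∀ j ∈ FL', -i₀ + 2 ≤ j := by
      intro j hj
      rw [hFL', Finset.mem_map] at hj
      obtain ⟨i, hi, rfl⟩ := hj
      have := h1 i hi
      simp; omega
    have h3 : FL'.card ≤ M := by rw [hFL', card_map]; exact (card_filter_le _ _).trans hcard
    have h4 := neg_le_sum_log_right hM (-i₀) h3 h2
    rw [hFL', sum_map] at h4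
    refine h4.trans (le_of_eq (sum_congr rfl fun i hi ↦ ?_))
    have h5 : (i : ℝ) ≤ i₀ - 2 := by exact_mod_cast h1 i hi
    simp only [Equiv.coe_toEmbedding, Equiv.neg_apply, Int.cast_neg]
    rw [abs_of_nonpos (by linarith)]
    ring_nf
  linarith

/-- Distance bound: if `t` lies in cell `i` of the grid of mesh `1/M` based at `x₀` (i.e.
`x₀ + i/M ≤ t ≤ x₀ + (i+1)/M`) and `x` has cell index `i₀ = ⌊(x - x₀) M⌋`, then
`|t - x| ≥ (|i - i₀| - 1)/M`. [folklore] -/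
theorem abs_sub_ge_of_mem_cell {x₀ : ℝ} {M : ℕ} (hM : 0 < M) {i : ℤ} {t : ℝ}
    (ht₁ : x₀ + i / M ≤ t) (ht₂ : t ≤ x₀ + (i + 1) / M) (x : ℝ) :
    (|(i : ℝ) - ⌊(x - x₀) * M⌋| - 1) / M ≤ |t - x| := by
  have hM' : (0 : ℝ) < M := by exact_mod_cast hM
  set i₀ : ℤ := ⌊(x - x₀) * M⌋ with hi₀
  have h1 : (i₀ : ℝ) ≤ (x - x₀) * M := Int.floor_le _
  have h2 : (x - x₀) * M < i₀ + 1 := Int.lt_floor_add_one _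
  -- `x ∈ [x₀ + i₀/M, x₀ + (i₀+1)/M)`
  have hx₁ : x₀ + i₀ / M ≤ x := by
    have : (i₀ : ℝ) / M ≤ x - x₀ := by rw [div_le_iff₀ hM']; exact h1
    linarith
  have hx₂ : x < x₀ + (i₀ + 1) / M := by
    have : x - x₀ < ((i₀ : ℝ) + 1) / M := by rw [lt_div_iff₀ hM']; exact h2
    linarith
  rw [div_le_iff₀ hM']
  -- case analysis on the relative position of the cells
  rcases lt_trichotomy i i₀ with hlt | heq | hgt
  · -- `i < i₀`: `x - t ≥ (i₀ - i - 1)/M`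
    have hii : (i : ℝ) + 1 ≤ i₀ := by exact_mod_cast hlt
    have hle : ((i₀ : ℝ) - i - 1) / M ≤ x - t := by
      have e1 : x₀ + ((i : ℝ) + 1) / M + ((i₀ : ℝ) - i - 1) / M = x₀ + i₀ / M := by
        field_simp; ring
      linarith
    calc (|(i : ℝ) - i₀| - 1) = ((i₀ : ℝ) - i - 1) := by
          rw [abs_of_neg (by linarith)]; ring
      _ = ((i₀ : ℝ) - i - 1) / M * M := by field_simp
      _ ≤ (x - t) * M := by gcongr
      _ ≤ |t - x| * M := by gcongr; rw [abs_sub_comm]; exact le_abs_self _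
  · -- same cell: the bound is `≤ 0`
    rw [heq, sub_self, abs_zero]
    have : 0 ≤ |t - x| * M := by positivity
    linarith
  · -- `i > i₀`: `t - x ≥ (i - i₀ - 1)/M`
    have hii : (i₀ : ℝ) + 1 ≤ i := by exact_mod_cast hgt
    have hle : ((i : ℝ) - i₀ - 1) / M ≤ t - x := by
      have e1 : x₀ + ((i₀ : ℝ) + 1) / M + ((i : ℝ) - i₀ - 1) / M = x₀ + i / M := by
        field_simp; ring
      linarith
    calc (|(i : ℝ) - i₀| - 1) = ((i : ℝ) - i₀ - 1) := by
          rw [abs_of_pos (by linarith)]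
      _ = ((i : ℝ) - i₀ - 1) / M * M := by field_simp
      _ ≤ (t - x) * M := by gcongr
      _ ≤ |t - x| * M := by gcongr; exact le_abs_self _

/-- **Grid lemma.** For finitely many complex points `a ∈ S` with multiplicities `m(a) ≥ 1`
(total `n = Σ m(a)`), a real base point `c` and the grid of `M = 12(n+1)` cells of
`[c - 1/2, c + 1/2]`, some cell carries the bound `∏_{a∈S} |t - a|^{m(a)} ≥ e^{-3n}` for all `t` in
it. (Cells at index distance `≥ 2` from every point are "free"; at most `3|S| ≤ 3n` cells are not;
for each point the free cells contribute `Σ log((|i-i₀|-1)/M) ≥ -2M` (`neg_le_sum_log_abs`), so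
the average over the `≥ 9n+12` free cells of `Σ_a m(a) log((|i-i₀(a)|-1)/M)` is `≥ -3n`.)
[folklore] -/
theorem exists_cell_prod_norm_sub_ge (S : Finset ℂ) (m : ℂ → ℕ) (hm : ∀ a ∈ S, 0 < m a) (c : ℝ) :
    ∃ i : ℕ, i < 12 * (∑ a ∈ S, m a + 1) ∧
      ∀ t : ℝ, c - 1 / 2 + i / (12 * (∑ a ∈ S, m a + 1) : ℕ) ≤ t →
        t ≤ c - 1 / 2 + (i + 1) / (12 * (∑ a ∈ S, m a + 1) : ℕ) →
          Real.exp (-(3 * ∑ a ∈ S, m a : ℕ)) ≤ ∏ a ∈ S, ‖(t : ℂ) - a‖ ^ m a := by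
  classical
  set n : ℕ := ∑ a ∈ S, m a with hn
  set M : ℕ := 12 * (n + 1) with hM
  have hMpos : 0 < M := by positivity
  have hM' : (0 : ℝ) < M := by exact_mod_cast hMpos
  set x₀ : ℝ := c - 1 / 2 with hx₀
  set idx : ℂ → ℤ := fun a ↦ ⌊(a.re - x₀) * M⌋ with hidx
  set good : ℕ → Prop := fun i ↦ ∀ a ∈ S, 2 ≤ |(i : ℤ) - idx a| with hgood
  set free : Finset ℕ := (range M).filter good with hfree
  -- occupied cells are few
  set near : ℂ → Finset ℕ := fun a ↦ (range M).filter (fun i : ℕ ↦ |((i : ℕ) : ℤ) - idx a| ≤ 1)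
    with hnear
  have hfiber : ∀ a ∈ S, (near a).card ≤ 3 := by
    intro a _
    calc (near a).card ≤ (Finset.Icc (idx a - 1) (idx a + 1)).card := by
          refine card_le_card_of_injOn (fun i : ℕ ↦ ((i : ℕ) : ℤ)) (fun i hi ↦ ?_)
            (fun i _ j _ h ↦ by exact_mod_cast (show ((i : ℕ) : ℤ) = ((j : ℕ) : ℤ) from h))
          rw [mem_coe, hnear, mem_filter, abs_le] at hi
          show ((i : ℕ) : ℤ) ∈ Finset.Icc (idx a - 1) (idx a + 1)
          rw [Finset.mem_Icc]
          omega
      _ = 3 := by rw [Int.card_Icc]; omega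
  have hocc : ((range M).filter (fun i ↦ ¬ good i)).card ≤ 3 * S.card := by
    calc ((range M).filter (fun i ↦ ¬ good i)).card ≤ (S.biUnion near).card := by
          refine card_le_card fun i hi ↦ ?_
          rw [mem_filter] at hi
          simp only [hgood, not_forall, not_le] at hi
          obtain ⟨a, ha, hlt⟩ := hi.2
          exact mem_biUnion.2 ⟨a, ha, mem_filter.2 ⟨hi.1, by omega⟩⟩
      _ ≤ ∑ a ∈ S, (near a).card := card_biUnion_le
      _ ≤ ∑ a ∈ S, 3 := sum_le_sum hfiber
      _ = 3 * S.card := by rw [sum_const, smul_eq_mul, mul_comm]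
  have hScard : S.card ≤ n := by
    rw [hn, card_eq_sum_ones]; exact sum_le_sum fun a ha ↦ hm a ha
  have hfree_card : M - 3 * n ≤ free.card := by
    have h := Finset.card_filter_add_card_filter_not (s := range M) good
    rw [card_range] at h
    rw [hfree]
    omega
  -- per-cell weights
  set L : ℕ → ℂ → ℝ := fun i a ↦ Real.log ((|(i : ℝ) - idx a| - 1) / M) with hL
  set W : ℕ → ℝ := fun i ↦ ∑ a ∈ S, m a * L i a with hW
  have hkey : ∀ a ∈ S, -(2 * M : ℝ) ≤ ∑ i ∈ free, L i a := by
    intro a ha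
    have hinj : Set.InjOn (fun i : ℕ ↦ ((i : ℕ) : ℤ)) free := fun i _ j _ h ↦ by
      exact_mod_cast (show ((i : ℕ) : ℤ) = ((j : ℕ) : ℤ) from h)
    have h := neg_le_sum_log_abs hMpos (idx a) (F := free.image (fun i : ℕ ↦ ((i : ℕ) : ℤ)))
      (card_image_le.trans ((card_filter_le _ _).trans (by rw [card_range])))
      (fun j hj ↦ by
        rw [Finset.mem_image] at hj
        obtain ⟨i, hi, rfl⟩ := hj
        exact (mem_filter.1 hi).2 a ha)
    rw [sum_image hinj] at h
    simpa [hL] using h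
  have htotal : -(2 * M * n : ℝ) ≤ ∑ i ∈ free, W i := by
    simp only [hW]
    rw [sum_comm]
    have hn' : (n : ℝ) = ∑ a ∈ S, (m a : ℝ) := by rw [hn]; push_cast; rfl
    have : -(2 * M * n : ℝ) = ∑ a ∈ S, (m a : ℝ) * (-(2 * M : ℝ)) := by
      rw [hn', mul_sum, ← sum_neg_distrib]
      refine sum_congr rfl fun a _ ↦ by ring
    rw [this]
    refine sum_le_sum fun a ha ↦ ?_
    rw [← mul_sum]
    exact mul_le_mul_of_nonneg_left (hkey a ha) (Nat.cast_nonneg _)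
  -- a free cell with weight `≥ -3n`
  have hfree_ne : free.Nonempty := by
    rw [← card_pos]; omega
  have hcmp : ∑ i ∈ free, (-(3 * n : ℝ)) ≤ ∑ i ∈ free, W i := by
    refine le_trans ?_ htotal
    rw [sum_const, nsmul_eq_mul]
    have h1 : ((M - 3 * n : ℕ) : ℝ) ≤ free.card := by exact_mod_cast hfree_card
    have h2 : ((M - 3 * n : ℕ) : ℝ) = M - 3 * n := by
      rw [Nat.cast_sub (by omega)]; push_cast; ring
    have hMn : (M : ℝ) = 12 * (n + 1) := by rw [hM]; push_cast; ring
    have hn0 : (0 : ℝ) ≤ n := Nat.cast_nonneg _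
    rw [h2] at h1
    nlinarith
  obtain ⟨i, hi, hWi⟩ := exists_le_of_sum_le hfree_ne hcmp
  have hiM : i < M := mem_range.1 (mem_filter.1 hi).1
  have higood : good i := (mem_filter.1 hi).2
  refine ⟨i, hiM, fun t ht₁ ht₂ ↦ ?_⟩
  -- on the cell, `log ‖t - a‖ ≥ L i a`
  have hdist : ∀ a ∈ S, (|(i : ℝ) - idx a| - 1) / M ≤ ‖(t : ℂ) - a‖ := by
    intro a _
    have ht₁' : x₀ + ((i : ℤ) : ℝ) / M ≤ t := by rw [Int.cast_natCast]; exact ht₁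
    have ht₂' : t ≤ x₀ + (((i : ℤ) : ℝ) + 1) / M := by rw [Int.cast_natCast]; exact ht₂
    have h := abs_sub_ge_of_mem_cell (x₀ := x₀) hMpos (i := (i : ℤ)) (t := t) ht₁' ht₂' a.re
    refine (le_of_eq ?_).trans (h.trans ?_)
    · simp [hidx]
    · have : t - a.re = ((t : ℂ) - a).re := by simp
      rw [this]; exact abs_re_le_norm _
  have hpos : ∀ a ∈ S, 0 < (|(i : ℝ) - idx a| - 1) / M := by
    intro a ha
    have : (2 : ℝ) ≤ |(i : ℝ) - idx a| := by
      have h := higood a ha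
      have : ((2 : ℤ) : ℝ) ≤ ((|(i : ℤ) - idx a| : ℤ) : ℝ) := by exact_mod_cast h
      push_cast at this
      exact this
    apply div_pos (by linarith) hM'
  have hnorm_pos : ∀ a ∈ S, 0 < ‖(t : ℂ) - a‖ := fun a ha ↦ (hpos a ha).trans_le (hdist a ha)
  have hlog : ∀ a ∈ S, L i a ≤ Real.log ‖(t : ℂ) - a‖ := fun a ha ↦
    Real.log_le_log (hpos a ha) (hdist a ha)
  calc Real.exp (-(3 * n : ℕ)) ≤ Real.exp (W i) := by
        refine Real.exp_le_exp.2 ?_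
        push_cast; linarith
    _ ≤ Real.exp (∑ a ∈ S, m a * Real.log ‖(t : ℂ) - a‖) := by
        refine Real.exp_le_exp.2 (sum_le_sum fun a ha ↦ ?_)
        exact mul_le_mul_of_nonneg_left (hlog a ha) (Nat.cast_nonneg _)
    _ = ∏ a ∈ S, ‖(t : ℂ) - a‖ ^ m a := by
        rw [Real.exp_sum]
        refine prod_congr rfl fun a ha ↦ ?_
        rw [Real.exp_nat_mul, Real.exp_log (hnorm_pos a ha)]

/-! ### Numerical constants -/

/-- `e^{-3} ≤ 15/230`. [folklore] -/
theorem exp_neg_three_le : Real.exp (-3) ≤ 15 / 230 := by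
  have h1 : (2.7182818283 : ℝ) < Real.exp 1 := Real.exp_one_gt_d9
  have h3 : Real.exp 3 = Real.exp 1 ^ 3 := by rw [← Real.exp_nat_mul]; norm_num
  have h2 : (230 / 15 : ℝ) ≤ Real.exp 3 := by
    rw [h3]
    calc (230 / 15 : ℝ) ≤ 2.7182818283 ^ 3 := by norm_num
      _ ≤ Real.exp 1 ^ 3 := by gcongr
  rw [Real.exp_neg, inv_le_comm₀ (Real.exp_pos _) (by norm_num), inv_div]
  exact h2

/-! ### The local minimum-modulus lemma -/

open ComplexConjugate in
/-- On the circle `‖w‖ = R`: `‖R² - conj(b) w‖ = R ‖w - b‖` (the Blaschke factor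
`R(w-b)/(R² - b̄w)` is unimodular on `‖w‖ = R`). [folklore] -/
theorem norm_sq_sub_conj_mul_eq {w b : ℂ} {R : ℝ} (hw : ‖w‖ = R) :
    ‖(R : ℂ) ^ 2 - conj b * w‖ = R * ‖w - b‖ := by
  have h1 : (R : ℂ) ^ 2 = w * conj w := by
    rw [Complex.mul_conj, Complex.normSq_eq_norm_sq, hw]; push_cast; ring
  rw [h1, show w * conj w - conj b * w = w * conj (w - b) by rw [map_sub]; ring, norm_mul,
    Complex.norm_conj, hw]

open ComplexConjugate in
/-- **Local minimum modulus on a real segment.** Let `f` be entire, `c ∈ ℝ`, `f(c) ≠ 0`, `U ≥ 0`,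
and `‖f(z)‖ ≤ e^U ‖f(c)‖` for `|z - c| ≤ 15`. Then there is `t₀` with
`[t₀, t₀ + 1/(12(U+1))] ⊂ [c - 1/2, c + 1/2]` on which `‖f(t)‖ ≥ e^{-(7U+1)} ‖f(c)‖`.
(Blaschke factorisation on `|z - c| ≤ 15` of the zeros in `|z - c| < 5`, maximum modulus, Jensen's
inequality `N(5) log 3 ≤ U`, Harnack's inequality for `log ‖h‖` on `|z - c| < 5`, and the grid
lemma `exists_cell_prod_norm_sub_ge` for the zeros in `|z - c| < 2`.)
[cite: Boas1954, §3.7] [cite: Titchmarsh1986, §3.9 (Lemma)] -/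
theorem exists_Icc_norm_ge_of_norm_le {f : ℂ → ℂ} (hf : Differentiable ℂ f) {c : ℝ} {U : ℝ}
    (hU : 0 ≤ U) (hfc : f c ≠ 0)
    (hbound : ∀ z ∈ closedBall (c : ℂ) 15, ‖f z‖ ≤ Real.exp U * ‖f c‖) :
    ∃ t₀ : ℝ, c - 1 / 2 ≤ t₀ ∧ t₀ + 1 / (12 * (U + 1)) ≤ c + 1 / 2 ∧
      ∀ t : ℝ, t₀ ≤ t → t ≤ t₀ + 1 / (12 * (U + 1)) →
        Real.exp (-(7 * U + 1)) * ‖f c‖ ≤ ‖f t‖ := by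
  classical
  have hfc_pos : 0 < ‖f c‖ := norm_pos_iff.2 hfc
  -- Step 0: extract the zeros in `ball c 16`; split them at radius `5`
  obtain ⟨S, m, g, hS, -, hgd, hg0, hfac⟩ := exists_finset_zeros_eq_prod_mul hf hfc 16
  set S₅ : Finset ℂ := S.filter (fun a ↦ ‖a - c‖ < 5) with hS₅
  set S' : Finset ℂ := S.filter (fun a ↦ ¬ ‖a - c‖ < 5) with hS'
  have hmem₅ : ∀ a ∈ S₅, ‖a - c‖ < 5 ∧ 0 < m a ∧ a ≠ c := by
    intro a ha
    rw [hS₅, mem_filter] at ha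
    refine ⟨ha.2, (hS a ha.1).2.1, fun h ↦ hfc ?_⟩
    rw [← h]; exact (hS a ha.1).1
  set G : ℂ → ℂ := fun z ↦ (∏ a ∈ S', (z - a) ^ m a) * g z with hG
  have hG_fac : ∀ z ∈ ball (c : ℂ) 16, f z = (∏ a ∈ S₅, (z - a) ^ m a) * G z := by
    intro z hz
    rw [hfac z hz, hG, ← mul_assoc, hS₅, hS', prod_filter_mul_prod_filter_not]
  have hGd : DifferentiableOn ℂ G (ball (c : ℂ) 16) :=
    (differentiable_prod_pow_sub S' m).differentiableOn.mul hgd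
  have hG0 : ∀ z ∈ ball (c : ℂ) 5, G z ≠ 0 := by
    intro z hz
    have hz16 : z ∈ ball (c : ℂ) 16 := ball_subset_ball (by norm_num) hz
    refine mul_ne_zero (prod_pow_sub_ne_zero m fun a ha h ↦ ?_) (hg0 z hz16)
    rw [hS', mem_filter] at ha
    apply ha.2
    rw [← h]; rwa [mem_ball, dist_eq_norm] at hz
  -- Step 1: the Blaschke-normalised function `h = G · E`
  set D : ℂ → ℂ → ℂ := fun a z ↦ (15 : ℂ) ^ 2 - conj (a - c) * (z - c) with hD
  set E : ℂ → ℂ := fun z ↦ ∏ a ∈ S₅, (D a z / 15) ^ m a with hE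
  set h : ℂ → ℂ := fun z ↦ G z * E z with hh
  have hEd : Differentiable ℂ E := by
    simp only [hE, hD]
    fun_prop
  have hhd : DifferentiableOn ℂ h (ball (c : ℂ) 16) := hGd.mul hEd.differentiableOn
  -- size of the denominators `D a z` for `‖z - c‖ ≤ 15`
  have hD_le : ∀ a ∈ S₅, ∀ z : ℂ, ‖z - c‖ ≤ 15 → ‖D a z‖ ≤ 225 + 5 * ‖z - c‖ := by
    intro a ha z hz
    simp only [hD]
    calc ‖(15 : ℂ) ^ 2 - conj (a - c) * (z - c)‖ ≤ ‖(15 : ℂ) ^ 2‖ + ‖conj (a - c) * (z - c)‖ :=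
          norm_sub_le _ _
      _ ≤ 225 + 5 * ‖z - c‖ := by
          rw [norm_mul, Complex.norm_conj]
          have : ‖(15 : ℂ) ^ 2‖ = 225 := by norm_num
          rw [this]
          gcongr
          exact (hmem₅ a ha).1.le
  have hD_ne : ∀ a ∈ S₅, ∀ z : ℂ, ‖z - c‖ ≤ 15 → D a z ≠ 0 := by
    intro a ha z hz h0
    have h1 : ‖conj (a - c) * (z - c)‖ < 225 := by
      rw [norm_mul, Complex.norm_conj]
      calc ‖a - c‖ * ‖z - c‖ ≤ 5 * 15 := mul_le_mul (hmem₅ a ha).1.le hz (norm_nonneg _) (by norm_num)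
        _ < 225 := by norm_num
    simp only [hD, sub_eq_zero] at h0
    rw [← h0] at h1
    norm_num at h1
  -- Step 2: `‖h‖ = ‖f‖` on the sphere `‖z - c‖ = 15`, hence `‖h‖ ≤ e^U ‖f c‖` on the disc
  have hnorm_f : ∀ z ∈ ball (c : ℂ) 16, ‖f z‖ = (∏ a ∈ S₅, ‖z - a‖ ^ m a) * ‖G z‖ := by
    intro z hz
    rw [hG_fac z hz, norm_mul, norm_prod]
    simp_rw [norm_pow]
  have hnorm_h : ∀ z, ‖h z‖ = ‖G z‖ * ∏ a ∈ S₅, (‖D a z‖ / 15) ^ m a := by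
    intro z
    simp only [hh, hE]
    rw [norm_mul, norm_prod]
    congr 1
    refine prod_congr rfl fun a _ ↦ ?_
    rw [norm_pow, norm_div]
    norm_num
  have hsphere : ∀ z : ℂ, ‖z - c‖ = 15 → ‖h z‖ = ‖f z‖ := by
    intro z hz
    have hz16 : z ∈ ball (c : ℂ) 16 := by rw [mem_ball, dist_eq_norm, hz]; norm_num
    rw [hnorm_h, hnorm_f z hz16, mul_comm]
    congr 1
    refine prod_congr rfl fun a _ ↦ ?_
    congr 1
    simp only [hD]
    rw [show ((15 : ℂ)) = ((15 : ℝ) : ℂ) by norm_num, norm_sq_sub_conj_mul_eq hz,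
      show z - ↑c - (a - ↑c) = z - a by ring]
    field_simp
  have h15 : (15 : ℝ) ≠ 0 := by norm_num
  have hh_le : ∀ z ∈ closedBall (c : ℂ) 15, ‖h z‖ ≤ Real.exp U * ‖f c‖ := by
    intro z hz
    refine Complex.norm_le_of_forall_mem_frontier_norm_le isBounded_ball
      (hhd.mono ?_).diffContOnCl (fun w hw ↦ ?_) (by rwa [closure_ball _ h15])
    · rw [closure_ball _ h15]; exact closedBall_subset_ball (by norm_num)
    · rw [frontier_ball _ h15, mem_sphere, dist_eq_norm] at hw
      rw [hsphere w hw]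
      exact hbound w (by rw [mem_closedBall, dist_eq_norm, hw])
  -- Step 3: at the centre, `3^{n₅} ‖f c‖ ≤ ‖h c‖ ≤ e^U ‖f c‖`
  set n₅ : ℕ := ∑ a ∈ S₅, m a with hn₅
  have hc16 : (c : ℂ) ∈ ball (c : ℂ) 16 := mem_ball_self (by norm_num)
  have hGc : ‖f c‖ = (∏ a ∈ S₅, ‖(c : ℂ) - a‖ ^ m a) * ‖G c‖ := hnorm_f c hc16
  have hhc : ‖h c‖ = ‖G c‖ * 15 ^ n₅ := by
    rw [hnorm_h, hn₅, ← prod_pow_eq_pow_sum]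
    congr 1
    refine prod_congr rfl fun a _ ↦ ?_
    simp [hD]
    norm_num
  have hprod_le : ∏ a ∈ S₅, ‖(c : ℂ) - a‖ ^ m a ≤ 5 ^ n₅ := by
    rw [hn₅, ← prod_pow_eq_pow_sum]
    refine prod_le_prod (fun a _ ↦ by positivity) fun a ha ↦ ?_
    refine pow_le_pow_left₀ (norm_nonneg _) ?_ _
    rw [norm_sub_rev]; exact (hmem₅ a ha).1.le
  have hGc_pos : 0 < ‖G c‖ := norm_pos_iff.2 (hG0 c (mem_ball_self (by norm_num)))
  have h3n : (3 : ℝ) ^ n₅ * ‖f c‖ ≤ ‖h c‖ := by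
    rw [hGc, hhc]
    calc (3 : ℝ) ^ n₅ * ((∏ a ∈ S₅, ‖(c : ℂ) - a‖ ^ m a) * ‖G c‖)
        ≤ 3 ^ n₅ * (5 ^ n₅ * ‖G c‖) := by gcongr
      _ = ‖G c‖ * 15 ^ n₅ := by rw [← mul_assoc, ← mul_pow]; norm_num; ring
  have hhc_le : ‖h c‖ ≤ Real.exp U * ‖f c‖ := hh_le c (mem_closedBall_self (by norm_num))
  have hn₅U : (n₅ : ℝ) ≤ U := by
    have h1 : (3 : ℝ) ^ n₅ ≤ Real.exp U := le_of_mul_le_mul_right (h3n.trans hhc_le) hfc_pos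
    have h2 : (n₅ : ℝ) * Real.log 3 ≤ U := by
      rw [← Real.log_pow, ← Real.log_exp U]
      exact Real.log_le_log (by positivity) h1
    have hlog3 : (1 : ℝ) ≤ Real.log 3 := by
      rw [Real.le_log_iff_exp_le (by norm_num)]
      have := Real.exp_one_lt_d9
      linarith
    nlinarith [Nat.cast_nonneg (α := ℝ) n₅]
  have hfc_le_hc : ‖f c‖ ≤ ‖h c‖ := by
    refine le_trans ?_ h3n
    have : (1 : ℝ) ≤ 3 ^ n₅ := one_le_pow₀ (by norm_num)
    nlinarith
  -- Step 4: Harnack for `log ‖h‖` on `ball c 5`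
  have hh5d : DifferentiableOn ℂ h (ball (c : ℂ) 5) := hhd.mono (ball_subset_ball (by norm_num))
  have hh0 : ∀ z ∈ ball (c : ℂ) 5, h z ≠ 0 := by
    intro z hz
    refine mul_ne_zero (hG0 z hz) (prod_ne_zero_iff.2 fun a ha ↦ pow_ne_zero _ ?_)
    refine div_ne_zero (hD_ne a ha z ?_) (by norm_num)
    rw [mem_ball, dist_eq_norm] at hz; linarith
  obtain ⟨φ, hφd, hφc, -, hφ⟩ := exists_log_on_ball hh5d hh0
  have hhc_pos : 0 < ‖h c‖ := hfc_pos.trans_le hfc_le_hc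
  have hlogh : ∀ z ∈ ball (c : ℂ) 5, Real.log ‖h z‖ = Real.log ‖h c‖ + (φ z).re := by
    intro z hz
    rw [hφ z hz, norm_mul, Complex.norm_exp, Real.log_mul hhc_pos.ne' (Real.exp_pos _).ne',
      Real.log_exp]
  set K : ℝ := U + 1 + Real.log ‖f c‖ - Real.log ‖h c‖ with hK
  set Q : ℂ → ℂ := fun z ↦ I * ((K : ℂ) - φ z) with hQ
  have hQd : DifferentiableOn ℂ Q (ball (c : ℂ) 5) :=
    ((differentiableOn_const (K : ℂ)).sub hφd).const_mul I
  have hQim : ∀ z, (Q z).im = K - (φ z).re := by intro z; simp [hQ]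
  have hlogh_le : ∀ z ∈ ball (c : ℂ) 5, Real.log ‖h z‖ ≤ U + Real.log ‖f c‖ := by
    intro z hz
    have hz15 : z ∈ closedBall (c : ℂ) 15 :=
      closedBall_subset_closedBall (by norm_num) (ball_subset_closedBall hz)
    calc Real.log ‖h z‖ ≤ Real.log (Real.exp U * ‖f c‖) :=
          Real.log_le_log (norm_pos_iff.2 (hh0 z hz)) (hh_le z hz15)
      _ = U + Real.log ‖f c‖ := by
          rw [Real.log_mul (Real.exp_pos _).ne' hfc_pos.ne', Real.log_exp]
  have hQpos : ∀ z ∈ ball (c : ℂ) 5, 0 < (Q z).im := by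
    intro z hz
    rw [hQim]
    have := hlogh z hz
    have := hlogh_le z hz
    simp only [hK]; linarith
  have hQc : (Q c).im ≤ U + 1 := by
    rw [hQim, hφc, Complex.zero_re, sub_zero, hK]
    have := Real.log_le_log hfc_pos hfc_le_hc
    linarith
  have hharnack : ∀ w : ℂ, ‖w - c‖ ≤ 1 → Real.exp (-((U + 1) / 2)) * ‖f c‖ ≤ ‖h w‖ := by
    intro w hw
    have hw5 : w ∈ ball (c : ℂ) 5 := by rw [mem_ball, dist_eq_norm]; linarith
    have hH := Complex.im_apply_le_harnack (by norm_num : (0 : ℝ) < 5) hQd hQpos hw5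
    have hratio : (5 + ‖w - c‖) / (5 - ‖w - c‖) ≤ 3 / 2 := by
      rw [div_le_div_iff₀ (by linarith) (by norm_num)]; linarith
    have h1 : (Q w).im ≤ (U + 1) * (3 / 2) := by
      calc (Q w).im ≤ (Q c).im * ((5 + ‖w - c‖) / (5 - ‖w - c‖)) := hH
        _ ≤ (U + 1) * (3 / 2) :=
          mul_le_mul hQc hratio (div_nonneg (by positivity) (by linarith)) (by linarith)
    rw [hQim, hK] at h1
    have h2 := hlogh w hw5
    have h3 : Real.log ‖f c‖ - (U + 1) / 2 ≤ Real.log ‖h w‖ := by linarith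
    have hhw_pos : 0 < ‖h w‖ := norm_pos_iff.2 (hh0 w hw5)
    calc Real.exp (-((U + 1) / 2)) * ‖f c‖ = Real.exp (Real.log ‖f c‖ - (U + 1) / 2) := by
          rw [sub_eq_add_neg, Real.exp_add, Real.exp_log hfc_pos, mul_comm]
      _ ≤ Real.exp (Real.log ‖h w‖) := Real.exp_le_exp.2 h3
      _ = ‖h w‖ := Real.exp_log hhw_pos
  -- Step 5: `‖f z‖ ≥ ‖h z‖ (15/230)^{n₅} ∏_{S₅} ‖z - a‖^{m a}` for `‖z - c‖ ≤ 1`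
  have hlower : ∀ z : ℂ, ‖z - c‖ ≤ 1 →
      ‖h z‖ * (15 / 230) ^ n₅ * ∏ a ∈ S₅, ‖z - a‖ ^ m a ≤ ‖f z‖ := by
    intro z hz
    have hz16 : z ∈ ball (c : ℂ) 16 := by rw [mem_ball, dist_eq_norm]; linarith
    rw [hnorm_f z hz16, hnorm_h z]
    have hDz : ∀ a ∈ S₅, ‖D a z‖ / 15 ≤ 230 / 15 := by
      intro a ha
      have := hD_le a ha z (by linarith)
      apply div_le_div_of_nonneg_right _ (by norm_num)
      linarith
    have h1 : ∏ a ∈ S₅, (‖D a z‖ / 15) ^ m a ≤ (230 / 15) ^ n₅ := by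
      rw [hn₅, ← prod_pow_eq_pow_sum]
      exact prod_le_prod (fun a _ ↦ by positivity) fun a ha ↦
        pow_le_pow_left₀ (by positivity) (hDz a ha) _
    have h2 : (∏ a ∈ S₅, (‖D a z‖ / 15) ^ m a) * (15 / 230) ^ n₅ ≤ 1 := by
      calc (∏ a ∈ S₅, (‖D a z‖ / 15) ^ m a) * (15 / 230) ^ n₅
          ≤ (230 / 15 : ℝ) ^ n₅ * (15 / 230) ^ n₅ := by gcongr
        _ = 1 := by rw [← mul_pow]; norm_num
    have hP0 : 0 ≤ ‖G z‖ * ∏ a ∈ S₅, ‖z - a‖ ^ m a := by positivity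
    calc ‖G z‖ * (∏ a ∈ S₅, (‖D a z‖ / 15) ^ m a) * (15 / 230) ^ n₅ * ∏ a ∈ S₅, ‖z - a‖ ^ m a
        = (‖G z‖ * ∏ a ∈ S₅, ‖z - a‖ ^ m a) *
            ((∏ a ∈ S₅, (‖D a z‖ / 15) ^ m a) * (15 / 230) ^ n₅) := by ring
      _ ≤ (‖G z‖ * ∏ a ∈ S₅, ‖z - a‖ ^ m a) * 1 := mul_le_mul_of_nonneg_left h2 hP0
      _ = (∏ a ∈ S₅, ‖z - a‖ ^ m a) * ‖G z‖ := by ring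
  -- Step 6: the zeros near the segment and the grid lemma
  set S₂ : Finset ℂ := S₅.filter (fun a : ℂ ↦ ‖a - c‖ < 2) with hS₂
  set n₂ : ℕ := ∑ a ∈ S₂, m a with hn₂
  have hn₂₅ : n₂ ≤ n₅ :=
    sum_le_sum_of_subset_of_nonneg (filter_subset _ _) (fun _ _ _ ↦ Nat.zero_le _)
  have hmid : ∀ z : ℂ, ‖z - c‖ ≤ 1 → ∏ a ∈ S₂, ‖z - a‖ ^ m a ≤ ∏ a ∈ S₅, ‖z - a‖ ^ m a := by
    intro z hz
    rw [hS₂, ← prod_filter_mul_prod_filter_not S₅ (fun a : ℂ ↦ ‖a - c‖ < 2)]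
    have hone : (1 : ℝ) ≤ ∏ a ∈ S₅.filter (fun a : ℂ ↦ ¬ ‖a - c‖ < 2), ‖z - a‖ ^ m a := by
      rw [← prod_const_one (s := S₅.filter (fun a : ℂ ↦ ¬ ‖a - c‖ < 2))]
      refine prod_le_prod (fun _ _ ↦ zero_le_one) fun a ha ↦ ?_
      have h2 : (2 : ℝ) ≤ ‖a - c‖ := not_lt.1 (mem_filter.1 ha).2
      refine one_le_pow₀ ?_
      have h3 : ‖a - c‖ ≤ ‖z - a‖ + ‖z - c‖ := by
        calc ‖a - c‖ = ‖(z - c) - (z - a)‖ := by congr 1; ring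
          _ ≤ ‖z - c‖ + ‖z - a‖ := norm_sub_le _ _
          _ = ‖z - a‖ + ‖z - c‖ := add_comm _ _
      linarith
    have hP0 : 0 ≤ ∏ a ∈ S₅.filter (fun a : ℂ ↦ ‖a - c‖ < 2), ‖z - a‖ ^ m a := by positivity
    nlinarith
  obtain ⟨i, hiM, hcell⟩ := exists_cell_prod_norm_sub_ge S₂ m
    (fun a ha ↦ (hmem₅ a (mem_filter.1 ha).1).2.1) c
  set M₂ : ℕ := 12 * (n₂ + 1) with hM₂
  have hM₂pos : (0 : ℝ) < M₂ := by positivity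
  have hn₂U : (n₂ : ℝ) ≤ U := le_trans (by exact_mod_cast hn₂₅) hn₅U
  have hlen : 1 / (12 * (U + 1)) ≤ 1 / (M₂ : ℝ) := by
    apply one_div_le_one_div_of_le hM₂pos
    rw [hM₂]; push_cast; linarith
  have hiM' : (i : ℝ) + 1 ≤ M₂ := by exact_mod_cast hiM
  refine ⟨c - 1 / 2 + i / M₂, by simp only [le_add_iff_nonneg_right]; positivity, ?_,
    fun t ht₁ ht₂ ↦ ?_⟩
  · have : ((i : ℝ) + 1) / M₂ ≤ 1 := by rw [div_le_one hM₂pos]; exact hiM'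
    have e : (i : ℝ) / M₂ + 1 / M₂ = ((i : ℝ) + 1) / M₂ := by ring
    linarith
  · have ht₂' : t ≤ c - 1 / 2 + ((i : ℝ) + 1) / M₂ := by
      have e : (i : ℝ) / M₂ + 1 / M₂ = ((i : ℝ) + 1) / M₂ := by ring
      linarith
    have hc := hcell t ht₁ ht₂'
    have htc : ‖(t : ℂ) - c‖ ≤ 1 := by
      have h1 : ((i : ℝ) + 1) / M₂ ≤ 1 := by rw [div_le_one hM₂pos]; exact hiM'
      have h2 : (0 : ℝ) ≤ i / M₂ := by positivity
      rw [← Complex.ofReal_sub, Complex.norm_real, Real.norm_eq_abs, abs_le]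
      constructor <;> linarith
    have h1 := hlower t htc
    have h2 := hharnack t htc
    have h3 := hmid t htc
    have h4 : Real.exp (-(3 * n₅ : ℝ)) ≤ (15 / 230 : ℝ) ^ n₅ := by
      rw [show (-(3 * n₅ : ℝ)) = n₅ * (-3) by ring, Real.exp_nat_mul]
      exact pow_le_pow_left₀ (Real.exp_pos _).le exp_neg_three_le _
    have h5 : Real.exp (-(3 * n₂ : ℝ)) ≤ ∏ a ∈ S₅, ‖(t : ℂ) - a‖ ^ m a := by
      refine le_trans (le_of_eq ?_) (hc.trans h3)
      rw [hn₂]; push_cast; rfl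
    -- assemble
    have hexp : Real.exp (-(7 * U + 1)) ≤
        Real.exp (-((U + 1) / 2)) * Real.exp (-(3 * n₅ : ℝ)) * Real.exp (-(3 * n₂ : ℝ)) := by
      rw [← Real.exp_add, ← Real.exp_add]
      exact Real.exp_le_exp.2 (by nlinarith)
    calc Real.exp (-(7 * U + 1)) * ‖f c‖
        ≤ Real.exp (-((U + 1) / 2)) * Real.exp (-(3 * n₅ : ℝ)) * Real.exp (-(3 * n₂ : ℝ)) * ‖f c‖ :=
          mul_le_mul_of_nonneg_right hexp (norm_nonneg _)
      _ = (Real.exp (-((U + 1) / 2)) * ‖f c‖) * Real.exp (-(3 * n₅ : ℝ)) *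
            Real.exp (-(3 * n₂ : ℝ)) := by ring
      _ ≤ ‖h t‖ * (15 / 230) ^ n₅ * ∏ a ∈ S₅, ‖(t : ℂ) - a‖ ^ m a := by
          gcongr
      _ ≤ ‖f t‖ := h1

end Literature.Analysis.Complex
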